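import Summits.QuantumFields.YangMills.Theorems.UnitScaleTiltProp7MassivePropagatorAgmon
import Summits.QuantumFields.YangMills.Theorems.UnitScaleTiltProp7LODProjectorGlue
import Summits.QuantumFields.YangMills.Theorems.UnitScaleTiltProp7SpanProjectorGramForm
import Summits.QuantumFields.YangMills.Theorems.UnitScaleTiltProp7CovLapSiteEntryRows
import HarnessLib

/-!
# Route `UnitScaleTilt`, crux K1 «MinimiserStabilityRegPr» (stmt-QuantumFields-19200), EX row `hGF[Lift]` ∕ `h349[Lift]` (curved member) — **LOD LINE BRICK (L5′-member), FILE B1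
# (routeR-w2 g12, LOCATE-L5-GRAMSHELLS 7416633c): PRINT'S COMPLEMENTARY GAUGE PROJECTOR `P(U₀) = 1 − R_{Q″}(U₀)` AT THE T³ MEMBER IS THE GRAM-INVERSE SUM OVER THE MASSIVE COLUMNS
# `G_a(T b_i)`, ITS BILINEAR FORM IS `Σ conj⟪G_aTb_i, f⟫ · M⁻¹_{ii′} · ⟪G_aTb_{i′}, g⟫`, AND EACH COLUMN PAIRING AGAINST A BLOCK-SUPPORTED FIELD IS EXPONENTIALLY SMALL IN THE WEIGHT
# BY px5's (A-L²) ROW.**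

Cell `ym3-torus` (HUMAN RULING D-0037, YM ladder rung R3 — NOT d = 4, NOT infinite volume, NOT a mass gap, NOT Clay).  Width seat `ym-routeR-w2` gen 12 (D-0154 (3c); chair ★p1 g24
22:12:46Z (4) «(L5′-member) GRAM SHELLS», 22:38:36Z road (L5′-G) + currency pin, 22:52:45Z «GO»; ★★OWNER RULINGS №33∕№35).  THEOREMS ONLY (0 `def`, 0 `sorry`); the member letters of
✓`Prop7MassivePropagatorCoercive`∕`…Agmon` (px5 g11: `Q''` with the `hseq` of record, the coarse reading `ι`, the hypothesis-form adjoint `T`, the massive inverse `G` with `hAG`∕`hGA` =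
✓`exists_massive_inverse`), ✓`Prop7LODProjectorGlue` (★p1 g24), ✓`Prop7SpanProjectorGramForm` (this seat), ✓`Prop7CovLapSiteEntryRows.isSymmetric_covLapSite` (px17 g8);
`--supports stmt-QuantumFields-19200 --as helper`, count-neutral.  HONEST LABEL (№33 (6)): curved γ-row ∕ (3.49) supplier line (LOD localisation); CONDITIONAL on the coarse Gram
coercivity `hcoer` (= (L4′): ✓`Prop7RTermFloor.norm_le_of_energy_interpolant` over (BUMP) ✓`Prop7CovariantBlockBumps`) where stated; nothing of (3.49), Thm 3.1∕3.3, `h349`,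
`hGF`, EX ∕ 19200 is proved here; no summit statement is proved by this seat.

THE MATHEMATICS.  `E := SiteL2K ℂ 3 (periodsT3 F K) c₀ W₂` (fine), `Fc := SiteL2K ℂ 3 (periodsT3 F n) c₁ W₂` (coarse), `Q := ι ∘ Q'' : E → Fc`, `T : Fc → E` its adjoint (`hT`),
`Δ := covLapSite F n K c₀ U₀`, `A := Δ + a·T∘Q`, `G := A⁻¹` (`hAG`, `hGA`).  §1: `ker(ι∘Q'') = ker Q''` (the reading `ι` is injective), so ✓`orthogonal_map_ker_eq_range_comp` reads
`((ker Q'').map Δ)ᗮ = range(G∘T)`; and `1 − projR Δ Q''` (lit ✓`B11Eq103H1Complex.projR` = `starProjection` of `(ker Q'').map Δ`) is the `starProjection` of that complement.  §2: for ANY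
orthonormal basis `b` of `Fc` the columns `v i := G(T(b i))` lie in and span the complement, and a coarse coercivity `m_B‖f‖ ≤ ‖G(T f)‖` makes their Gram matrix invertible
(✓`isUnit_gram_det_of_coercive`).  §3: hence ✓`Prop7SpanProjectorGramForm` applies BY NAME to print's `P = 1 − projR Δ Q''`: the Gram-inverse sum, the bilinear form, the pairing bound.
§4: the pairing `⟪G(T c̃), toL2S u⟫` of ONE column (source `T c̃ = toL2S t` supported in the block `B(y)` — px17 ✓`adjoint_apply_eq_zero_off_block`) against a field `u` supported in the
block `B(z)` is `≤ e^{−R}·8C_P²·‖T c̃‖·‖toL2S u‖` for every admissible Agmon weight `φ` (px5's window) vanishing on `B(y)` and `≥ R` on `B(z)` — (A-L²) of ✓`agmon_rows_exp` + a block cut.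
The exponential-in-distance edition (weights `φ = μη·dist(·,B(y))`, coarse volume) and the `M⁻¹` decay (✓`Prop7GramConjAccretive` at the member) are FILES B3∕B2.

WHAT IS PROVED (ns `Summit.QuantumFields.YangMills.Theorems.Prop7ComplementaryProjectorColumns`).
* §1 ★ `ker_lift_comp_eq` (the reading `ι` is injective), ★★ `orthogonal_map_ker_eq_range_massive`, ★ `sub_projR_eq_starProjection_orthogonal`.
* §2 `massive_column_mem`, `orthogonal_le_span_massive_columns`, ★ `isUnit_gram_massive_columns`, `norm_adjoint_le` (`‖T f‖ ≤ C_T‖f‖` from `‖ι(Q″λ)‖ ≤ C_T‖λ‖` by duality).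
* §3 ★★ `sub_projR_eq_gramSum`, ★★ `inner_sub_projR_eq_gramSum`, ★★★ `norm_inner_sub_projR_le` (print's `P` in Gram-inverse letters; the abstract-weight `P`-row).
* §4 `inner_toL2S_eq_inner_blockCut`, `norm_toL2S_blockCut_le_of_weight`, ★★★ `norm_inner_massive_column_le` (the (A-L²) column pairing bound).

References: T. Bałaban, CMP **99** (1985) 389–434 [Balaban1985BackgroundPropagators] ((3.16) p.393, (3.20)–(3.25) p.394, Thm 3.1 (3.46) p.398, (3.49) p.399); A. Målqvist,
D. Peterseim, Math. Comp. **83** (2014) 2583–2603 [folklore].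
-/

set_option autoImplicit false

noncomputable section

open scoped BigOperators Matrix.Norms.L2Operator InnerProductSpace ComplexConjugate Matrix

namespace Summit.QuantumFields.YangMills.Theorems.Prop7ComplementaryProjectorColumns

open Literature.MathematicalPhysics.QuantumFieldTheory.Balaban1983to89
open Finset
open T4Continuum BlockAveraging
open BlockAveraging (Idx)
open B7Prop1Explicit (U1 disp)
open B5Eq118OneStroke (iterBlockOf iterBlock)
open B10Eq27TorusAxialLog (holT transl)
open B7TransferAnalyticMean (meanCLM)
open B9Eq311L2Pairing (WL2)
open B11Eq103H1Complex (SiteL2K BondL2K projR)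
open Summit.QuantumFields.YangMills.Theorems.Prop8Chart (emlIterU)
open Literature.MathematicalPhysics.QuantumFieldTheory.Balaban1983to89.T3ContinuumYM3Torus
open T3SectALandauChart (eta eta_pos bgUnits)
open T3PrintedRegularMinimiser (RegPr)
open T3PrintedRegularOrbits (sites_eq)
open T3LevelShift (siteShift)
open Summit.QuantumFields.YangMills.Theorems.Prop7SectET3Transport (periodsT3)
open Summit.QuantumFields.YangMills.Theorems.Prop7SectET3HilbertLetters (W₂ toL2 toL2S DL2 DstarL2 covLapSite adjoint_DL2 inner_toL2)
open Summit.QuantumFields.YangMills.Theorems.Prop7SectET3RealCoordSums (inner_toL2S)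
open Summit.QuantumFields.YangMills.Theorems.Prop7MassivePropagatorAgmonLetters (normSq_lift_topMean_le norm_toL2S_smul_le)
open Summit.QuantumFields.YangMills.Theorems.Prop7MassivePropagatorAgmon (agmon_rows_exp)
open Summit.QuantumFields.YangMills.Theorems.Prop7LODProjectorGlue (orthogonal_map_ker_eq_range_comp)
open Summit.QuantumFields.YangMills.Theorems.Prop7SpanProjectorGramForm (starProjection_eq_gramSum inner_starProjection_eq_gramSum norm_inner_starProjection_le
  isUnit_gram_det_of_coercive)
open Summit.QuantumFields.YangMills.Theorems.Prop7CovLapSiteEntryRows (isSymmetric_covLapSite)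
open Summit.QuantumFields.YangMills.Theorems.Prop7SiteEntryCoordinates (norm_sq_sum_smul_orthonormalBasis)

variable (F : T3Family) {n K : ℕ} (h : n ≤ K) {c₀ c₁ : ℝ} [Fact (0 < c₀)] [Fact (0 < c₁)]
  {ε₀ : ℝ} (hε₀ : 0 < ε₀) (hε7 : 10 ^ 7 * (F.L : ℝ) ^ 3 * ε₀ ≤ 1)
  (U₀ : GaugeField (F.P K) 0 (Matrix.specialUnitaryGroup (Fin 2) ℂ)) (hreg : RegPr F n K ε₀ U₀)
  (Q'' : SiteL2K ℂ 3 (periodsT3 F K) c₀ W₂ →ₗ[ℂ] (Site (F.P K) (K - n) → Matrix (Fin 2) (Fin 2) ℂ))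
  (hseq : ∀ lam : Site (F.P K) 0 → Matrix (Fin 2) (Fin 2) ℂ, ∃ ns : (j : ℕ) → Site (F.P K) j → Matrix (Fin 2) (Fin 2) ℂ, ns 0 = lam ∧
      (∀ (j : ℕ) (y : Site (F.P K) (j + 1)), ns (j + 1) y = ns j (emb y) - meanCLM (Idx (F.P K)) (Matrix (Fin 2) (Fin 2) ℂ) fun i : Idx (F.P K) =>
        ns j (emb y) - ((holT (emlIterU j (bgUnits F K U₀)) (emb y) (stairWord i.2.1 (off i.1)) : (Matrix (Fin 2) (Fin 2) ℂ)ˣ) : Matrix (Fin 2) (Fin 2) ℂ) *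
          ns j (transl (emb y) (disp (stairWord i.2.1 (off i.1)))) * (((holT (emlIterU j (bgUnits F K U₀)) (emb y) (stairWord i.2.1 (off i.1)))⁻¹ : (Matrix (Fin 2) (Fin 2) ℂ)ˣ) : Matrix (Fin 2) (Fin 2) ℂ)) ∧
      ns (K - n) = Q'' (toL2S F K c₀ lam))
  (ι : (Site (F.P K) (K - n) → Matrix (Fin 2) (Fin 2) ℂ) →ₗ[ℂ] SiteL2K ℂ 3 (periodsT3 F n) c₁ W₂)
  (hι : ∀ c, ι c = toL2S F n c₁ (fun z => c (siteShift (sites_eq F n K h) z)))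
  (T : SiteL2K ℂ 3 (periodsT3 F n) c₁ W₂ →ₗ[ℂ] SiteL2K ℂ 3 (periodsT3 F K) c₀ W₂)
  (hT : ∀ (l : SiteL2K ℂ 3 (periodsT3 F K) c₀ W₂) (f : SiteL2K ℂ 3 (periodsT3 F n) c₁ W₂), ⟪ι (Q'' l), f⟫_ℂ = ⟪l, T f⟫_ℂ)
  {a : ℝ} (ha : 0 < a)
  (G : SiteL2K ℂ 3 (periodsT3 F K) c₀ W₂ →ₗ[ℂ] SiteL2K ℂ 3 (periodsT3 F K) c₀ W₂)
  (hAG : ∀ f, covLapSite F n K c₀ U₀ (G f) + (a : ℂ) • T (ι (Q'' (G f))) = f)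
  (hGA : ∀ u, G (covLapSite F n K c₀ U₀ u + (a : ℂ) • T (ι (Q'' u))) = u)

/-! ## §1 The complement `(Δ·ker Q″)ᗮ` is the range of `G ∘ T`; print's `1 − R_{Q″}` is its orthogonal projection -/

include hι in
omit [Fact (0 < c₀)] [Fact (0 < c₁)] in
/-- ★ `ker (ι ∘ Q'') = ker Q''`. [cite: Balaban1985BackgroundPropagators, (3.16) p.393, (3.20) p.394] -/
theorem ker_lift_comp_eq : LinearMap.ker (ι ∘ₗ Q'') = LinearMap.ker Q'' := by
  ext l
  rw [LinearMap.mem_ker, LinearMap.mem_ker, LinearMap.comp_apply]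
  -- the coarse reading `ι` (transport to the level-`n` lattice + `toL2S`) is injective
  have hinj : Function.Injective ι := by
    intro c c' hcc'
    rw [hι, hι] at hcc'
    have h1 := (toL2S F n c₁).injective hcc'
    funext y
    have := congrFun h1 ((siteShift (sites_eq F n K h)).symm y)
    simpa using this
  constructor
  · intro h0; exact hinj (by rw [h0, map_zero])
  · intro h0; rw [h0, map_zero]

include hι hT hAG hGA in
/-- ★★ **`(Δ_{U₀}·ker Q″)ᗮ = range (G_a ∘ T)`** at the member — ✓`Prop7LODProjectorGlue.orthogonal_map_ker_eq_range_comp` with `Q := ι ∘ Q''`, `Δ := covLapSite` (symmetric, px17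
✓`isSymmetric_covLapSite`) and the massive inverse `G`. [cite: Balaban1985BackgroundPropagators, (3.20)–(3.25) p.394] -/
theorem orthogonal_map_ker_eq_range_massive :
    ((LinearMap.ker Q'').map (covLapSite F n K c₀ U₀))ᗮ = LinearMap.range (G ∘ₗ T) := by
  rw [← ker_lift_comp_eq F h Q'' ι hι]
  refine orthogonal_map_ker_eq_range_comp (covLapSite F n K c₀ U₀) G (isSymmetric_covLapSite F U₀) (Q := ι ∘ₗ Q'') (T := T)
    (fun l c => hT l c) (a : ℂ) (fun v => ?_) (fun v => ?_)
  · show covLapSite F n K c₀ U₀ (G v) + (a : ℂ) • T (ι (Q'' (G v))) = v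
    exact hAG v
  · show G (covLapSite F n K c₀ U₀ v + (a : ℂ) • T (ι (Q'' v))) = v
    exact hGA v

/-- ★ **PRINT'S `P = 1 − R_{Q″}` IS THE ORTHOGONAL PROJECTION ONTO THE COMPLEMENT**: `g − projR Δ Q'' g = ((ker Q'').map Δ)ᗮ.starProjection g` (lit `projR` is the `starProjection` of
`(ker Q'').map Δ`; Mathlib `starProjection_orthogonal_val`). [cite: Balaban1985BackgroundPropagators, (3.21) p.394] -/
theorem sub_projR_eq_starProjection_orthogonal (g : SiteL2K ℂ 3 (periodsT3 F K) c₀ W₂) :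
    haveI : CompleteSpace ((LinearMap.ker Q'').map (covLapSite F n K c₀ U₀)) := FiniteDimensional.complete ℂ _
    g - projR (covLapSite F n K c₀ U₀) Q'' g = (((LinearMap.ker Q'').map (covLapSite F n K c₀ U₀))ᗮ).starProjection g := by
  haveI : CompleteSpace ((LinearMap.ker Q'').map (covLapSite F n K c₀ U₀)) := FiniteDimensional.complete ℂ _
  rw [Submodule.starProjection_orthogonal_val]
  rfl

/-! ## §2 The massive columns `G(T(b i))` over an orthonormal basis `b` of the coarse space: membership, spanning, invertible Gram matrix -/

section Columns

variable {ιc : Type*} [Fintype ιc] [DecidableEq ιc] (b : OrthonormalBasis ιc ℂ (SiteL2K ℂ 3 (periodsT3 F n) c₁ W₂))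

include hι hT hAG hGA in
omit [DecidableEq ιc] in
/-- Every massive column lies in the complement `(Δ·ker Q″)ᗮ`. [cite: Balaban1985BackgroundPropagators, (3.21)–(3.25) p.394] -/
theorem massive_column_mem (i : ιc) : G (T (b i)) ∈ ((LinearMap.ker Q'').map (covLapSite F n K c₀ U₀))ᗮ := by
  rw [orthogonal_map_ker_eq_range_massive F h U₀ Q'' ι hι T hT G hAG hGA]
  exact ⟨b i, rfl⟩

include hι hT hAG hGA in
omit [DecidableEq ιc] in
/-- The massive columns span the complement. [cite: Balaban1985BackgroundPropagators, (3.21)–(3.25) p.394] -/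
theorem orthogonal_le_span_massive_columns :
    ((LinearMap.ker Q'').map (covLapSite F n K c₀ U₀))ᗮ ≤ Submodule.span ℂ (Set.range fun i => G (T (b i))) := by
  rw [orthogonal_map_ker_eq_range_massive F h U₀ Q'' ι hι T hT G hAG hGA]
  rintro x ⟨f, rfl⟩
  have hf : f = ∑ i, ⟪b i, f⟫_ℂ • b i := (b.sum_repr' f).symm
  rw [LinearMap.comp_apply, hf, map_sum, map_sum]
  refine Submodule.sum_mem _ fun i _ => ?_
  rw [map_smul, map_smul]
  exact Submodule.smul_mem _ _ (Submodule.subset_span ⟨i, rfl⟩)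

/-- ★ **COARSE COERCIVITY ⟹ INVERTIBLE GRAM MATRIX OF THE MASSIVE COLUMNS**: `m_B‖f‖ ≤ ‖G(T f)‖` on `Fc` with `m_B > 0` ((L4′): ✓`Prop7RTermFloor.norm_le_of_energy_interpolant` over
(BUMP)) ⟹ `IsUnit (det M)`, `M i i′ = ⟪G(T(b i)), G(T(b i′))⟫`. [cite: Balaban1985BackgroundPropagators, (3.21) p.394, Thm 3.1 p.397] -/
theorem isUnit_gram_massive_columns {mB : ℝ} (hmB : 0 < mB) (hcoer : ∀ f : SiteL2K ℂ 3 (periodsT3 F n) c₁ W₂, mB * ‖f‖ ≤ ‖G (T f)‖) :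
    IsUnit (Matrix.of fun i i' : ιc => ⟪G (T (b i)), G (T (b i'))⟫_ℂ).det := by
  refine isUnit_gram_det_of_coercive (fun i => G (T (b i))) (M := Matrix.of fun i i' : ιc => ⟪G (T (b i)), G (T (b i'))⟫_ℂ) (fun i i' => rfl)
    (m₀ := mB ^ 2) (by positivity) fun c => ?_
  have hsum : ∑ i, c i • G (T (b i)) = G (T (∑ i, c i • b i)) := by
    rw [map_sum, map_sum]
    refine Finset.sum_congr rfl fun i _ => ?_
    rw [map_smul, map_smul]
  rw [hsum, ← norm_sq_sum_smul_orthonormalBasis b c, ← mul_pow]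
  have h0 : 0 ≤ mB * ‖∑ i, c i • b i‖ := mul_nonneg hmB.le (norm_nonneg _)
  exact pow_le_pow_left₀ h0 (hcoer _) 2

include hT in
omit [DecidableEq ιc] in
/-- **THE ADJOINT IS BOUNDED BY DUALITY**: `‖ι(Q″λ)‖ ≤ C_T‖λ‖` for all `λ` ⟹ `‖T f‖ ≤ C_T‖f‖`; at the member `C_T² = (25∕8)·κ` (px5 ✓`normSq_lift_topMean_le`, `κ = c₁((L^d)^{K−n})⁻¹∕c₀`).
[cite: Balaban1985BackgroundPropagators, (3.16) p.393, (3.24) p.394] -/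
theorem norm_adjoint_le {CT : ℝ} (hCT : 0 ≤ CT) (hQ : ∀ l : SiteL2K ℂ 3 (periodsT3 F K) c₀ W₂, ‖ι (Q'' l)‖ ≤ CT * ‖l‖)
    (f : SiteL2K ℂ 3 (periodsT3 F n) c₁ W₂) : ‖T f‖ ≤ CT * ‖f‖ := by
  have hsq : ‖T f‖ ^ 2 ≤ CT * ‖T f‖ * ‖f‖ := by
    have h1 : (‖T f‖ : ℝ) ^ 2 = RCLike.re ⟪T f, T f⟫_ℂ := by rw [inner_self_eq_norm_sq_to_K]; norm_cast
    rw [h1, ← hT]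
    calc RCLike.re ⟪ι (Q'' (T f)), f⟫_ℂ ≤ ‖⟪ι (Q'' (T f)), f⟫_ℂ‖ := RCLike.re_le_norm _
      _ ≤ ‖ι (Q'' (T f))‖ * ‖f‖ := norm_inner_le_norm _ _
      _ ≤ CT * ‖T f‖ * ‖f‖ := mul_le_mul_of_nonneg_right (hQ _) (norm_nonneg _)
  by_cases h0 : ‖T f‖ = 0
  · rw [h0]; positivity
  · have hpos : 0 < ‖T f‖ := lt_of_le_of_ne (norm_nonneg _) (Ne.symm h0)
    have : ‖T f‖ * ‖T f‖ ≤ (CT * ‖f‖) * ‖T f‖ := by rw [← sq]; linarith [hsq]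
    exact le_of_mul_le_mul_right this hpos

end Columns

/-! ## §3 Print's `P = 1 − projR Δ Q″` in Gram-inverse letters -/

section Rows

variable {ιc : Type*} [Fintype ιc] [DecidableEq ιc] (b : OrthonormalBasis ιc ℂ (SiteL2K ℂ 3 (periodsT3 F n) c₁ W₂))

include hι hT hAG hGA in
/-- ★★ **THE GRAM-INVERSE SUM FOR PRINT'S COMPLEMENTARY PROJECTOR**: with `v i := G(T(b i))`, `M i i′ := ⟪v i, v i′⟫` invertible,
`g − projR Δ Q'' g = Σ_i (Σ_{i′} M⁻¹ i i′ · ⟪v i′, g⟫) • v i`. [cite: Balaban1985BackgroundPropagators, (3.21)–(3.25) p.394] -/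
theorem sub_projR_eq_gramSum (hunit : IsUnit (Matrix.of fun i i' : ιc => ⟪G (T (b i)), G (T (b i'))⟫_ℂ).det) (g : SiteL2K ℂ 3 (periodsT3 F K) c₀ W₂) :
    g - projR (covLapSite F n K c₀ U₀) Q'' g
      = ∑ i, (∑ i', (Matrix.of fun i i' : ιc => ⟪G (T (b i)), G (T (b i'))⟫_ℂ)⁻¹ i i' * ⟪G (T (b i')), g⟫_ℂ) • G (T (b i)) := by
  haveI : CompleteSpace ((LinearMap.ker Q'').map (covLapSite F n K c₀ U₀)) := FiniteDimensional.complete ℂ _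
  rw [sub_projR_eq_starProjection_orthogonal]
  exact starProjection_eq_gramSum (fun i => G (T (b i))) (fun i i' => rfl) hunit _ (massive_column_mem F h U₀ Q'' ι hι T hT G hAG hGA b)
    (orthogonal_le_span_massive_columns F h U₀ Q'' ι hι T hT G hAG hGA b) g

include hι hT hAG hGA in
/-- ★★ **THE BILINEAR FORM OF PRINT'S `P`**: `⟪f, g − projR Δ Q'' g⟫ = Σ_i Σ_{i′} conj⟪v i, f⟫ · M⁻¹ i i′ · ⟪v i′, g⟫`. [cite: Balaban1985BackgroundPropagators, (3.21) p.394, (3.49) p.399] -/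
theorem inner_sub_projR_eq_gramSum (hunit : IsUnit (Matrix.of fun i i' : ιc => ⟪G (T (b i)), G (T (b i'))⟫_ℂ).det) (f g : SiteL2K ℂ 3 (periodsT3 F K) c₀ W₂) :
    ⟪f, g - projR (covLapSite F n K c₀ U₀) Q'' g⟫_ℂ
      = ∑ i, ∑ i', (starRingEnd ℂ) ⟪G (T (b i)), f⟫_ℂ * (Matrix.of fun i i' : ιc => ⟪G (T (b i)), G (T (b i'))⟫_ℂ)⁻¹ i i' * ⟪G (T (b i')), g⟫_ℂ := by
  haveI : CompleteSpace ((LinearMap.ker Q'').map (covLapSite F n K c₀ U₀)) := FiniteDimensional.complete ℂ _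
  rw [sub_projR_eq_starProjection_orthogonal]
  exact inner_starProjection_eq_gramSum (fun i => G (T (b i))) (fun i i' => rfl) hunit _ (massive_column_mem F h U₀ Q'' ι hι T hT G hAG hGA b)
    (orthogonal_le_span_massive_columns F h U₀ Q'' ι hι T hT G hAG hGA b) f g

include hι hT hAG hGA in
/-- ★★★ **THE `P`-ROW IN ABSTRACT-WEIGHT FORM**: pairing bounds `‖⟪v i, f⟫‖ ≤ A i`, `‖⟪v i′, g⟫‖ ≤ B i′` (§4 at the member) give
`‖⟪f, g − projR Δ Q'' g⟫‖ ≤ Σ_i Σ_{i′} A i · ‖M⁻¹ i i′‖ · B i′` — with ✓`Prop7GramConjAccretive`'s `‖M⁻¹ i i′‖ ≤ C_N e^{−μ″ dc}` and FILE B3's weights this is the block-to-block decay of the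
kernel of `P`, K-uniformly. [cite: Balaban1985BackgroundPropagators, (3.49) p.399] -/
theorem norm_inner_sub_projR_le (hunit : IsUnit (Matrix.of fun i i' : ιc => ⟪G (T (b i)), G (T (b i'))⟫_ℂ).det) (f g : SiteL2K ℂ 3 (periodsT3 F K) c₀ W₂)
    (A B : ιc → ℝ) (hA : ∀ i, ‖⟪G (T (b i)), f⟫_ℂ‖ ≤ A i) (hB : ∀ i', ‖⟪G (T (b i')), g⟫_ℂ‖ ≤ B i') :
    ‖⟪f, g - projR (covLapSite F n K c₀ U₀) Q'' g⟫_ℂ‖ ≤ ∑ i, ∑ i', A i * ‖(Matrix.of fun i i' : ιc => ⟪G (T (b i)), G (T (b i'))⟫_ℂ)⁻¹ i i'‖ * B i' := by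
  haveI : CompleteSpace ((LinearMap.ker Q'').map (covLapSite F n K c₀ U₀)) := FiniteDimensional.complete ℂ _
  rw [sub_projR_eq_starProjection_orthogonal]
  exact norm_inner_starProjection_le (fun i => G (T (b i))) (fun i i' => rfl) hunit _ (massive_column_mem F h U₀ Q'' ι hι T hT G hAG hGA b)
    (orthogonal_le_span_massive_columns F h U₀ Q'' ι hι T hT G hAG hGA b) f g A B hA hB

end Rows

/-! ## §4 One column against one block: the (A-L²) pairing bound -/

/-- A field supported in the block `B(z)` pairs with `toL2S g` as with the block cut of `g`. [cite: Balaban1985BackgroundPropagators, (3.11) p.392] -/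
theorem inner_toL2S_eq_inner_blockCut (g u : Site (F.P K) 0 → Matrix (Fin 2) (Fin 2) ℂ) (z : Site (F.P K) (K - n))
    (hu : ∀ x, iterBlockOf (K - n) x ≠ z → u x = 0) :
    ⟪toL2S F K c₀ g, toL2S F K c₀ u⟫_ℂ = ⟪toL2S F K c₀ (fun x => if iterBlockOf (K - n) x = z then g x else 0), toL2S F K c₀ u⟫_ℂ := by
  have h1 := inner_toL2S (F := F) (K := K) (c₀ := c₀) g u
  have h2 := inner_toL2S (F := F) (K := K) (c₀ := c₀) (fun x => if iterBlockOf (K - n) x = z then g x else 0) u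
  rw [h1, h2]
  refine congrArg (fun s : ℂ => (c₀ : ℂ) * s) (Finset.sum_congr rfl fun x _ => ?_)
  by_cases hx : iterBlockOf (K - n) x = z
  · simp only [if_pos hx]
  · simp only [if_neg hx, hu x hx, Matrix.mul_zero]

/-- **A BLOCK CUT UNDER A WEIGHT**: if `R ≤ φ` on the block `B(z)`, then `‖toL2S(𝟙_{B(z)}·g)‖ ≤ e^{−R}·‖toL2S(e^{φ}·g)‖` (pointwise `𝟙_{B(z)} = (𝟙_{B(z)}e^{−φ})·e^{φ}`, px5
✓`norm_toL2S_smul_le`). [cite: Balaban1985BackgroundPropagators, Thm 3.1 (3.46) p.398] -/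
theorem norm_toL2S_blockCut_le_of_weight (g : Site (F.P K) 0 → Matrix (Fin 2) (Fin 2) ℂ) (z : Site (F.P K) (K - n)) (φ : Site (F.P K) 0 → ℝ) {R : ℝ}
    (hφz : ∀ x, iterBlockOf (K - n) x = z → R ≤ φ x) :
    ‖toL2S F K c₀ (fun x => if iterBlockOf (K - n) x = z then g x else 0)‖ ≤ Real.exp (-R) * ‖toL2S F K c₀ (fun x => Real.exp (φ x) • g x)‖ := by
  set w : Site (F.P K) 0 → ℝ := fun x => if iterBlockOf (K - n) x = z then Real.exp (-φ x) else 0 with hw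
  set gφ : Site (F.P K) 0 → Matrix (Fin 2) (Fin 2) ℂ := fun x => Real.exp (φ x) • g x with hgφ
  have hcut : (fun x => if iterBlockOf (K - n) x = z then g x else 0) = fun x => w x • gφ x := by
    funext x
    by_cases hx : iterBlockOf (K - n) x = z
    · have h1 : w x = Real.exp (-φ x) := by rw [hw]; simp only [if_pos hx]
      rw [h1, hgφ]; simp only [if_pos hx]
      rw [smul_smul, ← Real.exp_add, neg_add_cancel, Real.exp_zero, one_smul]
    · have h1 : w x = 0 := by rw [hw]; simp only [if_neg hx]
      rw [h1, zero_smul]; simp only [if_neg hx]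
  rw [hcut]
  refine norm_toL2S_smul_le F (K := K) (c₀ := c₀) w (Real.exp_pos (-R)).le (fun x => ?_) gφ
  by_cases hx : iterBlockOf (K - n) x = z
  · have h1 : w x = Real.exp (-φ x) := by rw [hw]; simp only [if_pos hx]
    rw [h1, abs_of_pos (Real.exp_pos _)]; exact Real.exp_le_exp.mpr (neg_le_neg (hφz x hx))
  · have h1 : w x = 0 := by rw [hw]; simp only [if_neg hx]
    rw [h1, abs_zero]; exact (Real.exp_pos _).le

include hε₀ hε7 hreg hseq hι hT ha hAG in
/-- ★★★ **THE COLUMN PAIRING BOUND FROM (A-L²)**: a coarse source `c̃` whose column source `T c̃ = toL2S t` is supported in the block `B(y)`, a field `u` supported in the block `B(z)`, and an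
admissible Agmon weight (px5's window: per-bond slope `θ`, in-block oscillation `θ′`, `3η⁻²(e^θ−1)² + a(25∕8)κ(e^{θ′}−1)² ≤ δ₁²`, `C_Pδ₁ ≤ 1∕10`) with `φ = 0` on `B(y)` and `R ≤ φ` on `B(z)`:
`‖⟪G(T c̃), toL2S u⟫‖ ≤ e^{−R}·8C_P²·‖T c̃‖·‖toL2S u‖`, `C_P² = max 2 (16c₀(L^{K−n})³∕(a c₁))`.  (FILE B3: `φ := μη·dist(·,B(y))`, `R = μ·(tdist(z,y) − 2)`.)
[cite: Balaban1985BackgroundPropagators, Thm 3.1 (3.46) p.398, (3.49) p.399] -/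
theorem norm_inner_massive_column_le (c : SiteL2K ℂ 3 (periodsT3 F n) c₁ W₂) (t : Site (F.P K) 0 → Matrix (Fin 2) (Fin 2) ℂ) (ht : T c = toL2S F K c₀ t)
    (y : Site (F.P K) (K - n)) (hty : ∀ x, iterBlockOf (K - n) x ≠ y → t x = 0)
    (φ : Site (F.P K) 0 → ℝ) (φc : Site (F.P K) (K - n) → ℝ) {θ θ' : ℝ} (hθ' : 0 ≤ θ')
    (hφ : ∀ bd : PBond (F.P K) 0, |φ bd.tgt - φ bd.src| ≤ θ) (hφc : ∀ x : Site (F.P K) 0, |φ x - φc (iterBlockOf (K - n) x)| ≤ θ')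
    {δ₁ : ℝ} (hδ₁ : 0 ≤ δ₁)
    (hδ : 3 * ((eta F n K)⁻¹) ^ 2 * (Real.exp θ - 1) ^ 2 + a * ((25 / 8) * (c₁ * ((((F.P K).L : ℝ) ^ (F.P K).d) ^ (K - n))⁻¹ / c₀)) * (Real.exp θ' - 1) ^ 2 ≤ δ₁ ^ 2)
    (hwin : Real.sqrt (max 2 (16 * c₀ * ((F.L : ℝ) ^ (K - n)) ^ 3 / (a * c₁))) * δ₁ ≤ 1 / 10)
    (hφy : ∀ x, iterBlockOf (K - n) x = y → φ x = 0) (z : Site (F.P K) (K - n)) {R : ℝ} (hφz : ∀ x, iterBlockOf (K - n) x = z → R ≤ φ x)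
    (u : Site (F.P K) 0 → Matrix (Fin 2) (Fin 2) ℂ) (hu : ∀ x, iterBlockOf (K - n) x ≠ z → u x = 0) :
    ‖⟪G (T c), toL2S F K c₀ u⟫_ℂ‖ ≤ Real.exp (-R) * (8 * max 2 (16 * c₀ * ((F.L : ℝ) ^ (K - n)) ^ 3 / (a * c₁))) * ‖T c‖ * ‖toL2S F K c₀ u‖ := by
  -- the column as a lattice function
  set g : Site (F.P K) 0 → Matrix (Fin 2) (Fin 2) ℂ := (toL2S F K c₀).symm (G (T c)) with hg_def
  have hg : toL2S F K c₀ g = G (T c) := (toL2S F K c₀).apply_symm_apply _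
  -- its massive equation `A(toL2S g) = toL2S t`
  have hAu : covLapSite F n K c₀ U₀ (toL2S F K c₀ g) + (a : ℂ) • T (ι (Q'' (toL2S F K c₀ g))) = toL2S F K c₀ t := by rw [hg, hAG, ht]
  -- (A-L²)
  have hA := (agmon_rows_exp F h hε₀ hε7 U₀ hreg Q'' hseq ι hι T hT ha φ φc hθ' hφ hφc hδ₁ hδ hwin g t hAu).1
  -- the weighted source is the source (`φ = 0` on its support)
  have hsrc : (fun x => Real.exp (φ x) • t x) = t := by
    funext x
    by_cases hx : iterBlockOf (K - n) x = y
    · rw [hφy x hx, Real.exp_zero, one_smul]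
    · rw [hty x hx, smul_zero]
  rw [hsrc, ← ht] at hA
  -- the pairing only sees the block cut
  rw [← hg, inner_toL2S_eq_inner_blockCut F (n := n) (K := K) (c₀ := c₀) g u z hu]
  have hcut := norm_toL2S_blockCut_le_of_weight F (n := n) (K := K) (c₀ := c₀) g z φ hφz
  have hsq : Real.sqrt (max 2 (16 * c₀ * ((F.L : ℝ) ^ (K - n)) ^ 3 / (a * c₁))) ^ 2 = max 2 (16 * c₀ * ((F.L : ℝ) ^ (K - n)) ^ 3 / (a * c₁)) :=
    Real.sq_sqrt (le_trans (by norm_num) (le_max_left _ _))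
  rw [hsq] at hA
  calc ‖⟪toL2S F K c₀ (fun x => if iterBlockOf (K - n) x = z then g x else 0), toL2S F K c₀ u⟫_ℂ‖
      ≤ ‖toL2S F K c₀ (fun x => if iterBlockOf (K - n) x = z then g x else 0)‖ * ‖toL2S F K c₀ u‖ := norm_inner_le_norm _ _
    _ ≤ (Real.exp (-R) * ‖toL2S F K c₀ (fun x => Real.exp (φ x) • g x)‖) * ‖toL2S F K c₀ u‖ := mul_le_mul_of_nonneg_right hcut (norm_nonneg _)
    _ ≤ (Real.exp (-R) * (8 * max 2 (16 * c₀ * ((F.L : ℝ) ^ (K - n)) ^ 3 / (a * c₁)) * ‖T c‖)) * ‖toL2S F K c₀ u‖ :=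
        mul_le_mul_of_nonneg_right (mul_le_mul_of_nonneg_left hA (Real.exp_pos _).le) (norm_nonneg _)
    _ = _ := by ring

end Summit.QuantumFields.YangMills.Theorems.Prop7ComplementaryProjectorColumns

end
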